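import Literature.MathematicalPhysics.QuantumFieldTheory.Balaban1983to89.B9Eq3132KnitTentRebase
import Literature.MathematicalPhysics.QuantumFieldTheory.Balaban1983to89.B9Thm311PosDefQknitOfRegYP335AtLettersY

/-!
# `Balaban1983to89.B9Eq3132KnitTestFamilyP2` — T. Bałaban, *Propagators and renormalization transformations for lattice gauge theories. II*, Commun. Math. Phys.
# **96** (1984) 223–250 [Balaban1984PropagatorsII], (2.147) p. 248 with [Balaban1985BackgroundPropagators] (3.115) p. 418, (3.132) p. 422, (3.35) p. 396: (P′2) FOR PRINT's
# KNIT AVERAGING `Q(U) = QknitY` — the transported tent bumps with ROW-REBASED amplitudes are an approximate right inverse of `Q(U)` against `Λ⁻¹` on the class (3.35):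
# `(1 − 15∕16)·‖Ψ‖² ≤ Re tr⟨Q(U)(T_θΨ♭), Λ⁻¹Ψ⟩`, `Ψ♭(ι) = R(T_ι⁻¹)Ψ(ι)`, under x-free numerics

statement-level skeleton of published theorems with citation tags; proofs where landed; nothing here is a claim about the Yang–Mills mass gap

THE PRINT.  [4] p. 248 (2.147) *«⟨λ, QGQ*λ⟩ ≥ γ₀ Σ_y Λ_y²|λ(y)|² with a positive constant γ₀ depending on d and L only»* — stated for print's `Q`, which in [B9] Sect. D
(3.115) p. 418 IS the composite (knit) averaging of [5] (*Averaging operations …*, CMP **98** (1985), (15)–(23) pp. 19–21); (3.132) p. 422 *«as in [4] (2.147)»*; (3.35) p. 396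
(the class); (3.12)–(3.15) pp. 392–393 (the centre-taxi reading `Q_Y(U)` of this tree).

WHY THIS FILE (cell `pub-ymgap`, N06, seat `dag-n06-l` gen 38; road «P-Q26-knit» piece 6).  n06-i's (P′2) `B9Eq3132ApproxRightInverse.p2_bump` is the approximate right
inverse AT def-Y's centre-taxi letter `Q_Y(U) = QY parBY U`; row 26 at the knit pair (`Summit….N06Eq3132FromStateKnitQ`) wants it at `Q(U) = QknitY U`.  This seat's
`B9Eq3115KnitLetterYRowCloseness` gives `(Q(U)A)(ι) ≈ R(T_ι)((Q_Y(U)A)(ι))` row by row on (3.35) (`T_ι = U(Γ^{taxi}_{c→x₀})⁻¹` unitary), dag-n06-j converted it to the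
`trIP` currency (`B9Thm311PosDefQknitOfRegYP335AtLettersY.trIP_w_QknitY_sub_rebase_le`, `δ² = (α₀′m₀)²·2Nb₁` against the weight `c_f²(L^{lev b})⁻²`).  THE MOVE: feed the tents
with `Ψ♭(ι) := R(T_ι⁻¹)Ψ(ι)`; then `⟨R_T Q_Y(U)(T_θΨ♭), Λ⁻¹Ψ⟩₁ = ⟨Q_Y(U)(T_θΨ♭), Λ⁻¹Ψ♭⟩₁ ≥ ⅛‖Ψ♭‖² = ⅛‖Ψ‖²` (n06-i at `Ψ♭`; conjugations are isometries and commute with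
`Λ⁻¹`), and the knit error `⟨(Q − R_TQ_Y)(T_θΨ♭), Λ⁻¹Ψ⟩₁` is bounded by weighted Cauchy–Schwarz: `‖·‖²_w ≤ δ²·2(d+1)C_Θ‖Ψ‖²` (`B9Eq3132KnitTentRebase.sum_wgt_hs_tentOp_le`) times
`‖Λ⁻¹Ψ‖²_{w⁻¹} ≤ b₀⁻¹‖Ψ‖²` (the band from below); under the x-free numeric `δ²·2(d+1)C_Θ ≤ b₀∕256` the error is `≤ ‖Ψ‖²∕16`, whence (P′2)ᴷ with `ϑ = 15∕16`.

WHAT IS PROVED (sorry-free, 0 `def`).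
* §1 `rebase_unit_mem` (the row units are unitary on (3.35)), `trIP_rebase_self` (`‖Ψ♭‖ = ‖Ψ‖`), ★ `trIP_rowConj_QY_lamInv` (the main-term identity), `QknitY_split`.
* §2 ★ `trIP_w_knitErr_tent_le` (`‖(Q − R_TQ_Y)(T_θΨ♭)‖²_w ≤ δ²·2(d+1)C_Θ·‖Ψ‖²`), ★ `abs_knitErr_pairing_le` (the error pairing `≤ ‖Ψ‖²∕16` under the numeric).
* §3 ★★★ `p2_knit` — `(1 − 15∕16)·⟨Ψ,Ψ⟩₁ ≤ ⟨Q(U)(T_θΨ♭), Λ⁻¹Ψ⟩₁` for every `U ∈ (bg9KP … SU(N) i).Reg335 c₀ α₀` (`c₀ ≤ 10`, `0 ≤ Mα₀`), x-free numerics `0 < α₀′ ≤ α_Q`,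
  `K_pl(Mα₀)L⁴ < α₀′`, `(α₀′m₀)²·2Nb₁·2(d+1)C_Θ ≤ b₀∕256`, `0 < b₀`, `0 ≤ b₁`.

HONEST SCOPE.  A composition of LANDED theorems by name (n06-i's (P′2) and tents, this seat's row closeness, dag-n06-j's ℓ² conversion) with elementary Hilbert-space
bookkeeping; the class (3.35) and the numerics are hypotheses; nothing of [B9]∕[4] newly asserted; count-neutral; row 26 ∕ N06 NOT discharged; nothing continuum ∕ OS ∕ mass
gap ∕ Clay.  NEW file.  No `sorry`, no `axiom`, no `instance`, no `notation`, no `def`.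
-/

noncomputable section

namespace Literature.MathematicalPhysics.QuantumFieldTheory.Balaban1983to89.B9Eq3132KnitTestFamilyP2

open Node00
open B6KLevelCensusIndexV1 (KIdx kGeo)
open B6GlobalChartV1 (PV)
open B9Thm311ReadingCoords (trIP)
open B9Thm311DeltaPrimePos (trIP_self_nonneg trIP_add_right)
open B9Eq3132CoerciveVariational (trIP_comm trIP_sub_left)
open B9Eq39Adjoint (R R_inv_R R_R_inv)
open B9Eq3132NuReading (lamY lamInvY)
open B9Eq3132TentOperator (tentOp)
open B9Eq3132ApproxRightInverse (bumpProfile p2_bump)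
open B9Eq3132TentBumps (Cth)
open B9Eq3132KnitTentRebase (trIP_one_rowConj_left trIP_rowConj_self rowConj_real_smul abs_trIP_one_le_of_sq trIP_one_add_left trIP_winv_lamInv_le
  sum_wgt_hs_tentOp_le)
open B9Eq3115KnitLetterY (QknitY zSrc)
open B9Eq3115KnitLetterYOnto (kCol kCol_nonneg)
open B9Eq3115KnitLetterYRowCloseness (rebase_mem_unitary)
open B9Thm311PosDefQknitOfRegYP335AtLettersY (trIP_w_QknitY_sub_rebase_le)
open B9Eq316AveragingTransposeZd (alphaQ)
open B9C2FormBoxRegimeY (Kpl)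
open B9BackgroundsKLevelV1 (levV1)
open B9BackgroundsKLevelV1P (bg9KP mem_of_reg335P)
open B7Prop2SpecialUnitary (specialUnitaryUnits specialUnitaryUnits_le_unitaryUnits)
open scoped Matrix Matrix.Norms.L2Operator

variable {d ℓ : ℕ} {hd : 1 ≤ d + 1} {hL : Odd (ℓ + 1) ∧ 1 < ℓ + 1} {b₀ b₁ : ℝ} {N : ℕ}
variable (i : KIdx d ℓ hd hL b₀ b₁) {G : Subgroup (Matrix (Fin N) (Fin N) ℂ)ˣ}

/-! ## §1 The row units, the rebased amplitude `Ψ♭(ι) = R(T_ι⁻¹)Ψ(ι)`, the main-term identity -/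

section Rebase

/-- the row units `T_ι = U(Γ^{taxi}_{c→x₀})⁻¹` are unitary at a member of the class (3.35) (`G ≤ U(N)`). [cite: Balaban1985BackgroundPropagators, (3.40) p.397, (3.35) p.396, bookkeeping] -/
theorem rebase_unit_mem (hGU : G ≤ B7Prop2Explicit.unitaryUnits (Matrix (Fin N) (Fin N) ℂ))
    {U : CfgY (Matrix (Fin N) (Fin N) ℂ) i} {c₀ α₀ : ℝ} (hreg : (bg9KP (Matrix (Fin N) (Fin N) ℂ) G i).Reg335 c₀ α₀ U)
    (T : IBondY i → (Matrix (Fin N) (Fin N) ℂ)ˣ)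
    (hT : ∀ ι, T ι = (parTaxiV U (B15DeterminingSets.embIter (ι.1.1 : ℕ) ι.1.2.src)
      (B10Eq27TorusAxialLog.transl (0 : Site (PV d ℓ i.m i.K hd hL) 0) (B7Prop1Local.loK (ℓ + 1) (ι.1.1 : ℕ) (zSrc i ι))))⁻¹) (ι : IBondY i) :
    T ι ∈ B7Prop2Explicit.unitaryUnits (Matrix (Fin N) (Fin N) ℂ) ∧ (T ι)⁻¹ ∈ B7Prop2Explicit.unitaryUnits (Matrix (Fin N) (Fin N) ℂ) := by
  have h := rebase_mem_unitary i hGU hreg ι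
  rw [← hT ι] at h
  exact ⟨h, Subgroup.inv_mem _ h⟩

/-- `‖Ψ♭‖ = ‖Ψ‖`: the rebased amplitude has the same norm. [cite: Balaban1985BackgroundPropagators, p.393 (scalar products), (3.3) p.390] -/
theorem trIP_rebase_self (T : IBondY i → (Matrix (Fin N) (Fin N) ℂ)ˣ) (hTu : ∀ ι, (T ι)⁻¹ ∈ B7Prop2Explicit.unitaryUnits (Matrix (Fin N) (Fin N) ℂ))
    (Ψ : IBondY i → Matrix (Fin N) (Fin N) ℂ) :
    trIP (fun _ => (1 : ℝ)) (fun ι => R (T ι)⁻¹ (Ψ ι)) (fun ι => R (T ι)⁻¹ (Ψ ι)) = trIP (fun _ => (1 : ℝ)) Ψ Ψ :=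
  trIP_rowConj_self _ (fun ι => (T ι)⁻¹) hTu Ψ

/-- ★ **THE MAIN-TERM IDENTITY**: `⟨R_T(Q_Y(U)A), Λ⁻¹Ψ⟩₁ = ⟨Q_Y(U)A, Λ⁻¹Ψ♭⟩₁` — the row conjugations pass to the other side as their inverses and commute with the real row
scalars `Λ_ι⁻¹`. [cite: Balaban1984PropagatorsII, (2.147) p.248; Balaban1985BackgroundPropagators, (3.13) p.393, p.393 (scalar products)] -/
theorem trIP_rowConj_QY_lamInv (T : IBondY i → (Matrix (Fin N) (Fin N) ℂ)ˣ) (hTu : ∀ ι, T ι ∈ B7Prop2Explicit.unitaryUnits (Matrix (Fin N) (Fin N) ℂ))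
    (U : CfgY (Matrix (Fin N) (Fin N) ℂ) i) (A : FBondY i → Matrix (Fin N) (Fin N) ℂ) (Ψ : IBondY i → Matrix (Fin N) (Fin N) ℂ) :
    trIP (fun _ => (1 : ℝ)) (fun ι => R (T ι) (QY i (parBY i) U A ι)) (fun ι => lamInvY i ι • Ψ ι)
      = trIP (fun _ => (1 : ℝ)) (QY i (parBY i) U A) (fun ι => lamInvY i ι • R (T ι)⁻¹ (Ψ ι)) := by
  rw [trIP_one_rowConj_left T hTu, rowConj_real_smul (fun ι => (T ι)⁻¹)]

/-- `Q(U)A = R_T(Q_Y(U)A) + (Q(U)A − R_T(Q_Y(U)A))`, as functions. [cite: Balaban1985BackgroundPropagators, (3.115) p.418, (3.13) p.393, bookkeeping] -/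
theorem QknitY_split [Nonempty (Fin N)] (T : IBondY i → (Matrix (Fin N) (Fin N) ℂ)ˣ) (U : CfgY (Matrix (Fin N) (Fin N) ℂ) i) (A : FBondY i → Matrix (Fin N) (Fin N) ℂ) :
    (QknitY i U A : IBondY i → Matrix (Fin N) (Fin N) ℂ)
      = (fun ι => R (T ι) (QY i (parBY i) U A ι)) + fun ι => QknitY i U A ι - R (T ι) (QY i (parBY i) U A ι) := by
  funext ι
  simp only [Pi.add_apply, add_sub_cancel]

end Rebase

/-! ## §2 The knit error term on the tents -/

section Error

variable [Nonempty (Fin N)]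

/-- ★ **THE KNIT ERROR ON THE TENTS, `w`-NORM**: `‖(Q(U) − R_TQ_Y(U))(T_θΦ)‖²_w ≤ δ²·2(d+1)C_Θ(d)·‖Φ‖²`, `δ² = (α₀′m₀)²·2Nb₁`, for every member background of
`(bg9KP … G i).Reg335 c₀ α₀` (`G ≤ U(N)`, `c₀ ≤ 10`, `0 ≤ Mα₀`) under the numerics `0 < α₀′ ≤ α_Q`, `K_pl(Mα₀)L⁴ < α₀′`, `0 ≤ b₁` — dag-n06-j's ℓ²-closeness at `A = T_θΦ` times
the member-uniform tent weight. [cite: Balaban1985BackgroundPropagators, (3.115) p.418, (3.12)–(3.15) pp.392–393, (3.35) p.396; Balaban1984PropagatorsII, (2.147) p.248; Balaban1985Averaging, (139)–(147) pp.39–40] -/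
theorem trIP_w_knitErr_tent_le (hGU : G ≤ B7Prop2Explicit.unitaryUnits (Matrix (Fin N) (Fin N) ℂ)) (hb₁ : 0 ≤ b₁)
    {U : CfgY (Matrix (Fin N) (Fin N) ℂ) i} {c₀ α₀ : ℝ} (hc : c₀ ≤ 10) (hMα : 0 ≤ (kGeo i).M * α₀)
    (hreg : (bg9KP (Matrix (Fin N) (Fin N) ℂ) G i).Reg335 c₀ α₀ U) {α₀' : ℝ} (hα' : 0 < α₀') (hαQ : α₀' ≤ alphaQ (d + 1) (ℓ + 1))
    (hK : Kpl i ((kGeo i).M * α₀) * (kGeo i).L ^ 4 < α₀') (T : IBondY i → (Matrix (Fin N) (Fin N) ℂ)ˣ)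
    (hT : ∀ ι, T ι = (parTaxiV U (B15DeterminingSets.embIter (ι.1.1 : ℕ) ι.1.2.src)
      (B10Eq27TorusAxialLog.transl (0 : Site (PV d ℓ i.m i.K hd hL) 0) (B7Prop1Local.loK (ℓ + 1) (ι.1.1 : ℕ) (zSrc i ι))))⁻¹)
    (Φ : IBondY i → Matrix (Fin N) (Fin N) ℂ) :
    trIP i.w (fun ι => QknitY i U (tentOp i (bumpProfile i) U Φ) ι - R (T ι) (QY i (parBY i) U (tentOp i (bumpProfile i) U Φ) ι))
        (fun ι => QknitY i U (tentOp i (bumpProfile i) U Φ) ι - R (T ι) (QY i (parBY i) U (tentOp i (bumpProfile i) U Φ) ι))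
      ≤ (α₀' * (2 * ((d : ℝ) + 1) * kCol (d + 1) (ℓ + 1) + 8 * ((d : ℝ) + 2) ^ 2)) ^ 2 * (2 * (N : ℝ) * b₁) * (2 * ((d : ℝ) + 1) * Cth d)
          * trIP (fun _ => (1 : ℝ)) Φ Φ := by
  have hUu : ∀ μ x, U μ x ∈ B7Prop2Explicit.unitaryUnits (Matrix (Fin N) (Fin N) ℂ) := fun μ x => hGU (mem_of_reg335P (G := G) i hreg μ x)
  have h1 := trIP_w_QknitY_sub_rebase_le i hGU hb₁ hc hMα hreg hα' hαQ hK T hT (tentOp i (bumpProfile i) U Φ)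
  have h2 := sum_wgt_hs_tentOp_le i hUu Φ
  have hδ : 0 ≤ (α₀' * (2 * ((d : ℝ) + 1) * kCol (d + 1) (ℓ + 1) + 8 * ((d : ℝ) + 2) ^ 2)) ^ 2 * (2 * (N : ℝ) * b₁) := by positivity
  calc _ ≤ _ := h1
    _ ≤ (α₀' * (2 * ((d : ℝ) + 1) * kCol (d + 1) (ℓ + 1) + 8 * ((d : ℝ) + 2) ^ 2)) ^ 2 * (2 * (N : ℝ) * b₁) * (2 * ((d : ℝ) + 1) * Cth d * trIP (fun _ => (1 : ℝ)) Φ Φ) :=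
        mul_le_mul_of_nonneg_left h2 hδ
    _ = _ := by ring

/-- ★ **THE KNIT ERROR PAIRING**: `|⟨(Q(U) − R_TQ_Y(U))(T_θΨ♭), Λ⁻¹Ψ⟩₁| ≤ ‖Ψ‖²∕16` under the x-free numeric `(α₀′m₀)²·2Nb₁·2(d+1)C_Θ ≤ b₀∕256` (`0 < b₀`; and `‖Ψ♭‖ = ‖Ψ‖`) —
weighted Cauchy–Schwarz with `‖Λ⁻¹Ψ‖²_{w⁻¹} ≤ b₀⁻¹‖Ψ‖²`. [cite: Balaban1984PropagatorsII, (2.147) p.248, (2.16) p.225; Balaban1985BackgroundPropagators, (3.115) p.418, (3.35) p.396] -/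
theorem abs_knitErr_pairing_le (hGU : G ≤ B7Prop2Explicit.unitaryUnits (Matrix (Fin N) (Fin N) ℂ)) (hb₀ : 0 < b₀) (hb₁ : 0 ≤ b₁)
    {U : CfgY (Matrix (Fin N) (Fin N) ℂ) i} {c₀ α₀ : ℝ} (hc : c₀ ≤ 10) (hMα : 0 ≤ (kGeo i).M * α₀)
    (hreg : (bg9KP (Matrix (Fin N) (Fin N) ℂ) G i).Reg335 c₀ α₀ U) {α₀' : ℝ} (hα' : 0 < α₀') (hαQ : α₀' ≤ alphaQ (d + 1) (ℓ + 1))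
    (hK : Kpl i ((kGeo i).M * α₀) * (kGeo i).L ^ 4 < α₀')
    (hT16 : (α₀' * (2 * ((d : ℝ) + 1) * kCol (d + 1) (ℓ + 1) + 8 * ((d : ℝ) + 2) ^ 2)) ^ 2 * (2 * (N : ℝ) * b₁) * (2 * ((d : ℝ) + 1) * Cth d) ≤ b₀ / 256)
    (T : IBondY i → (Matrix (Fin N) (Fin N) ℂ)ˣ)
    (hT : ∀ ι, T ι = (parTaxiV U (B15DeterminingSets.embIter (ι.1.1 : ℕ) ι.1.2.src)
      (B10Eq27TorusAxialLog.transl (0 : Site (PV d ℓ i.m i.K hd hL) 0) (B7Prop1Local.loK (ℓ + 1) (ι.1.1 : ℕ) (zSrc i ι))))⁻¹)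
    (Ψ : IBondY i → Matrix (Fin N) (Fin N) ℂ) :
    |trIP (fun _ => (1 : ℝ))
        (fun ι => QknitY i U (tentOp i (bumpProfile i) U (fun ι => R (T ι)⁻¹ (Ψ ι))) ι
          - R (T ι) (QY i (parBY i) U (tentOp i (bumpProfile i) U (fun ι => R (T ι)⁻¹ (Ψ ι))) ι))
        (fun ι => lamInvY i ι • Ψ ι)| ≤ (1 / 16) * trIP (fun _ => (1 : ℝ)) Ψ Ψ := by
  have hTu := fun ι => (rebase_unit_mem i hGU hreg T hT ι).2
  have hE := trIP_w_knitErr_tent_le i hGU hb₁ hc hMα hreg hα' hαQ hK T hT (fun ι => R (T ι)⁻¹ (Ψ ι))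
  rw [trIP_rebase_self i T hTu Ψ] at hE
  have hΦ := trIP_winv_lamInv_le i hb₀ Ψ
  refine abs_trIP_one_le_of_sq i.w i.hw _ _ (trIP_self_nonneg _ (fun _ => one_pos) Ψ) (by norm_num) hE hΦ ?_
  have hb : b₀ ≠ 0 := hb₀.ne'
  calc (α₀' * (2 * ((d : ℝ) + 1) * kCol (d + 1) (ℓ + 1) + 8 * ((d : ℝ) + 2) ^ 2)) ^ 2 * (2 * (N : ℝ) * b₁) * (2 * ((d : ℝ) + 1) * Cth d) * b₀⁻¹
      ≤ b₀ / 256 * b₀⁻¹ := mul_le_mul_of_nonneg_right hT16 (inv_nonneg.2 hb₀.le)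
    _ = (1 / 16) ^ 2 := by field_simp; norm_num

end Error

/-! ## §3 ★★★ (P′2) for the knit letter -/

section P2

variable [Nonempty (Fin N)]

/-- ★★★ **(P′2)ᴷ — THE REBASED TENT BUMPS ARE AN APPROXIMATE RIGHT INVERSE OF PRINT's KNIT AVERAGING `Q(U)` AGAINST `Λ⁻¹`, ON THE CLASS (3.35)**: for every member
background `U ∈ (bg9KP … SU(N) i).Reg335 c₀ α₀` (`c₀ ≤ 10`, `0 ≤ Mα₀`), the row units `T_ι = U(Γ^{taxi}_{c→x₀})⁻¹`, x-free numerics `0 < α₀′ ≤ α_Q(d+1,L)`, `K_pl(Mα₀)L⁴ < α₀′`,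
`(α₀′m₀)²·2Nb₁·2(d+1)C_Θ(d) ≤ b₀∕256` (`m₀ = 2(d+1)K(d+1,L) + 8(d+2)²`), `0 < b₀`, `0 ≤ b₁`, and every `Ψ`:
`(1 − 15∕16)·⟨Ψ,Ψ⟩₁ ≤ Re tr⟨Q(U)(T_θΨ♭), Λ⁻¹Ψ⟩`, `Ψ♭(ι) = R(T_ι⁻¹)Ψ(ι)`, `T_θ = tentOp (bumpProfile)`.
[cite: Balaban1984PropagatorsII, (2.147) p.248; Balaban1985BackgroundPropagators, (3.132) p.422, (3.115) p.418, (3.13) p.393, (3.35) p.396; Balaban1985Averaging, (139)–(147) pp.39–40] -/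
theorem p2_knit (hb₀ : 0 < b₀) (hb₁ : 0 ≤ b₁)
    {U : CfgY (Matrix (Fin N) (Fin N) ℂ) i} {c₀ α₀ : ℝ} (hc : c₀ ≤ 10) (hMα : 0 ≤ (kGeo i).M * α₀)
    (hreg : (bg9KP (Matrix (Fin N) (Fin N) ℂ) (specialUnitaryUnits (Fin N)) i).Reg335 c₀ α₀ U) {α₀' : ℝ} (hα' : 0 < α₀') (hαQ : α₀' ≤ alphaQ (d + 1) (ℓ + 1))
    (hK : Kpl i ((kGeo i).M * α₀) * (kGeo i).L ^ 4 < α₀')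
    (hT16 : (α₀' * (2 * ((d : ℝ) + 1) * kCol (d + 1) (ℓ + 1) + 8 * ((d : ℝ) + 2) ^ 2)) ^ 2 * (2 * (N : ℝ) * b₁) * (2 * ((d : ℝ) + 1) * Cth d) ≤ b₀ / 256)
    (T : IBondY i → (Matrix (Fin N) (Fin N) ℂ)ˣ)
    (hT : ∀ ι, T ι = (parTaxiV U (B15DeterminingSets.embIter (ι.1.1 : ℕ) ι.1.2.src)
      (B10Eq27TorusAxialLog.transl (0 : Site (PV d ℓ i.m i.K hd hL) 0) (B7Prop1Local.loK (ℓ + 1) (ι.1.1 : ℕ) (zSrc i ι))))⁻¹)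
    (Ψ : IBondY i → Matrix (Fin N) (Fin N) ℂ) :
    (1 - 15 / 16) * trIP (fun _ => (1 : ℝ)) Ψ Ψ ≤
      trIP (fun _ => (1 : ℝ)) (QknitY i U (tentOp i (bumpProfile i) U (fun ι => R (T ι)⁻¹ (Ψ ι)))) (fun ι => lamInvY i ι • Ψ ι) := by
  have hGU := specialUnitaryUnits_le_unitaryUnits (n := Fin N)
  have hUsu : ∀ μ x, U μ x ∈ specialUnitaryUnits (Fin N) := fun μ x => mem_of_reg335P (G := specialUnitaryUnits (Fin N)) i hreg μ x
  have hTu := fun ι => rebase_unit_mem i hGU hreg T hT ι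
  set Ψf : IBondY i → Matrix (Fin N) (Fin N) ℂ := fun ι => R (T ι)⁻¹ (Ψ ι) with hΨf
  set A := tentOp i (bumpProfile i) U Ψf with hA
  -- split `Q(U)A` into the rebased centre-taxi term and the knit error
  rw [QknitY_split i T U A, trIP_one_add_left]
  -- main term: n06-i's (P′2) at `Ψ♭`
  have hmain : (1 - 7 / 8) * trIP (fun _ => (1 : ℝ)) Ψ Ψ ≤ trIP (fun _ => (1 : ℝ)) (fun ι => R (T ι) (QY i (parBY i) U A ι)) (fun ι => lamInvY i ι • Ψ ι) := by
    rw [trIP_rowConj_QY_lamInv i T (fun ι => (hTu ι).1) U A Ψ, ← trIP_rebase_self i T (fun ι => (hTu ι).2) Ψ]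
    exact p2_bump i hUsu Ψf
  -- error term
  have herr := abs_knitErr_pairing_le i hGU hb₀ hb₁ hc hMα hreg hα' hαQ hK hT16 T hT Ψ
  have herr' := (abs_le.1 herr).1
  linarith

end P2

end Literature.MathematicalPhysics.QuantumFieldTheory.Balaban1983to89.B9Eq3132KnitTestFamilyP2

end
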